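import Summits.QuantumFields.BalabanUV.T4Continuum.Support.VariationalVectorGaugeSlice

/-!
# T⁴ programme, spine node NE2 (U1a), lane P2 — LEAF V-GF, file 2: (SLICE) AT `U = 1` WITH `σ′ = σ = 0` FOR BAŁABAN's PROJECTED GAUGE FUNCTIONAL —
# every fibre of the flat line-sum average meets the zero set of `projG 1 (ker Q′_1)` EXACTLY ONCE along each gauge orbit, at no curl cost;
# and the dictionary `(G⁻¹K)ᗮ = G(Kᗮ)` behind «`I − P = Π_{Δ(ker Q′)}`» (model level)

NE2 formalisation swarm `b2b-balaban-t4-ne2-formalise-*`, leaf prover 09 GEN 7 (`prover-b2b-balaban-t4-ne2-formalise-leaf-09-g7-0`); journal INTENT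
CLAIMS.log 2026-08-20 14:4xZ «V-GF AT U = 1».  On top of file 1 `VariationalVectorGaugeSlice` (`projG`, `exists_gauge_projG_eq_zero`,
`lapOp_eq_of_projG_eq_zero`, `curlSq_sub_cDv_flat`, `QvL_cDv_flat_eq_zero`, `avgOp`) and, BY NAME, `VariationalAssemblySlice` (p220652: the bracket whose
binder `hslice` this file inhabits at `U = 1`), `B5LaplaceSpectral.const_of_shift_invariant` (pv15).

THE STATEMENTS (model level; `E` a finite-dimensional complex Hilbert space; level `n`, coarse torus `Tor M`; FLAT data `R = 1`, `T′ = 1`; `K := ker Q′_1` the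
block-mean kernel `kerAvgFlat`).
 * §4 **`slice_flat`**: `∀ W ∃ Ws, Q_1 Ws = Q_1 W ∧ curlSq 1 Ws = curlSq 1 W ∧ projG 1 K Ws = 0` (`Ws = W − D_1λ`, `λ ∈ K`: file 1's gauge move; the curl
   form is gauge invariant at `U = 1`; the flat line-sum average is blind to `D_1(ker Q′_1)` by [Balaban1984PropagatorsI] (1.19) SHAPE `QvL_cDv_flat`);
   **`hslice_flat`** ∕ `hslice_flat'` = `VariationalAssemblySlice.vector_pair_bracket_sqrt_slice_line`'s binder `hslice` with `σ′ = σ = 0`, `G := projG 1 K`, at the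
   flat product line transports `lineT 1 1` resp. the constant transports `1` (every level `n = L^k`; leaf-10-g3's announced `towerLimitRate_effV_of_leaves_slice`
   socket `hslice k` with `σ k = 0`);
   **`slice_flat_unique`**: two gauge moves from `K` reaching the zero set coincide (`Δλ = 0 ⟹ λ` constant — `const_of_shift_invariant_vec` — and `Q′_1 c = c`,
   `Qcv_flat_const`): each gauge orbit-in-fibre `{W − D_1λ : λ ∈ ker Q′_1}` meets `{projG = 0}` EXACTLY ONCE — the function-world content of (1.46)
   «∫dλ δ(Q_kλ)|det(Δ↾N(Q_k))| δ_R(∂*A − Δλ) = 1» (p. 26) for `R := Π_{Δ(ker Q′)}`; `eq_zero_of_projG_gradient_eq_zero` (transversality: `projG 1 K (D_1λ) = 0`,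
   `λ ∈ K ⟹ λ = 0` — what distinguishes `projG` from the trivial inhabitant `G = 0` of (SLICE));
 * §5 **`orthogonal_map_symm_eq`**: `(G⁻¹K)ᗮ = G(Kᗮ)` for a symmetric linear automorphism `G` of an inner-product space and any subspace `K`, and
   `orthogonal_map_orthogonal_eq` `(G(Kᗮ))ᗮ = G⁻¹K` (finite dimension).  With `G = Δ⁻¹` on `1^⊥`, `K = ker Q′`: (1.70)'s `P` is the orthogonal projection onto
   `Δ⁻¹(range Q′*) = G(Kᗮ)`, so `I − P = Π_{Δ(ker Q′)}` — the reading behind `projG` (the instantiation on pv15's matrices `B5Value126.PcT` is NOT made here).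
NOT HERE: (GF3) ((1.90), `n`-uniform); background; the END's matrix ∕ `Gtr` plumbing for `projG`.

HONEST FRAMING (T4-DAG p. 1).  Model level; flat data; [folklore] linear algebra; the identification with (1.46) ∕ (1.70) is a reading, not kernel; nothing printed
is a hypothesis; one `abbrev` (`kerAvgFlat := ker (avgOp 1)`), no `def … : Prop`, no `sorry`; axioms standard.  (SLICE) is ONE of the two binders on `G` — (GF3)
for `projG` stays DISPLAYED; V-GF with background OPEN; V-END ∕ NE2 NOT proved; NE3 OPEN; spine PROVED 0∕9 unchanged; rung (B)+1 finite T⁴ — NOT infinite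
volume, NOT mass gap, NOT Clay.  HONEST DEPENDENCY (cell, verbatim): continuum YM on T⁴ ⇐ BetaPertH ∧ nine spine estimates (0/9 proved); BetaPertH ⇐ (D1) ∧
(D4) ∧ CAP+tail; G-an2-4 gates asym, D1 and NE2/3/4.
-/

noncomputable section

namespace Summit.QuantumFields.BalabanUV.T4Continuum.VariationalVectorGaugeSliceFlat

open Finset WithLp
open scoped InnerProductSpace
open Literature.MathematicalPhysics.QuantumFieldTheory.Balaban1983to89.B5Prop11Plancherel (Tor fine unitVec)
open Summit.QuantumFields.BalabanUV.T4Continuum.VariationalColourFederbush (cDv Qcv)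
open Summit.QuantumFields.BalabanUV.T4Continuum.VariationalVectorWeitzenbock (divV divSq)
open Summit.QuantumFields.BalabanUV.T4Continuum.VariationalVectorForm (curlSq ScV qWV)
open Summit.QuantumFields.BalabanUV.T4Continuum.VectorBlockTrialForm (QvL)
open Summit.QuantumFields.BalabanUV.T4Continuum.VariationalVectorFederbush (lineT)
open Summit.QuantumFields.BalabanUV.T4Continuum.VariationalVectorGaugeSlice

variable {d : ℕ}
variable {E : Type*} [NormedAddCommGroup E]

/-! ## §4 THE SLICE AT `U = 1`: every fibre of the flat line-sum average meets the zero set of `projG 1 (ker Q′_1)` at NO curl cost (σ′ = σ = 0) -/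

section SliceFlat

variable [InnerProductSpace ℂ E] [CompleteSpace E] [FiniteDimensional ℂ E]
variable (n : ℕ) [NeZero n] (M : Fin d → ℕ) [hM : ∀ μ, NeZero (M μ)]

/-- the block-mean kernel `ker Q′_1` of `E`-valued fine 0-forms — the `K` of the road at `U = 1` (DATA of `projG` in general). [folklore] -/
abbrev kerAvgFlat : Submodule ℂ (Tor (fine n M) → E) := LinearMap.ker (avgOp n M (fun _ => (1 : E →L[ℂ] E)))

/-- **(SLICE) AT `U = 1`, σ′ = σ = 0**: for every level-`n` 1-form `W` there is `Ws` IN THE SAME FIBRE of the flat line-sum average, with THE SAME curl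
form, and `projG 1 (ker Q′_1) Ws = 0`; concretely `Ws = W − D_1 λ` with `λ ∈ ker Q′_1`. [folklore] -/
theorem slice_flat (W : Tor (fine n M) → Fin d → E) :
    ∃ Ws, QvL n M (lineT n M (fun _ => (1 : E →L[ℂ] E)) (fun _ _ => (1 : E →L[ℂ] E))) Ws
          = QvL n M (lineT n M (fun _ => (1 : E →L[ℂ] E)) (fun _ _ => (1 : E →L[ℂ] E))) W ∧
      curlSq (fine n M) (fun _ _ => (1 : E →L[ℂ] E)) Ws = curlSq (fine n M) (fun _ _ => (1 : E →L[ℂ] E)) W ∧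
      projG (fine n M) (fun _ _ => (1 : E →L[ℂ] E)) (kerAvgFlat n M) Ws = 0 := by
  obtain ⟨f, hfK, hf⟩ := exists_gauge_projG_eq_zero (fine n M) (fun _ _ => (1 : E →L[ℂ] E)) (kerAvgFlat n M) W
  refine ⟨W - cDv (fine n M) (fun _ _ => (1 : E →L[ℂ] E)) f, ?_, curlSq_sub_cDv_flat (fine n M) W f, hf⟩
  rw [QvL_sub, QvL_cDv_flat_eq_zero n M (by simpa using hfK), sub_zero]

/-- **(SLICE) AT `U = 1` IN THE BRACKET's LETTERS** — `VariationalAssemblySlice.vector_pair_bracket_sqrt_slice_line`'s binder `hslice` with `σ′ = σ = 0`,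
`G := projG 1 (ker Q′_1)`, `R := 1`, `Qk :=` the flat line-sum average (every level `n`): `ScV n M 1 G Ws ≤ ScV n M 1 0 W + 0·ScV n M 1 0 W + 0·qWV W`
(in fact `=`). [folklore] -/
theorem hslice_flat (W : Tor (fine n M) → Fin d → E) :
    ∃ Ws, QvL n M (lineT n M (fun _ => (1 : E →L[ℂ] E)) (fun _ _ => (1 : E →L[ℂ] E))) Ws
          = QvL n M (lineT n M (fun _ => (1 : E →L[ℂ] E)) (fun _ _ => (1 : E →L[ℂ] E))) W ∧
      ScV n M (fun _ _ => (1 : E →L[ℂ] E)) (projG (fine n M) (fun _ _ => (1 : E →L[ℂ] E)) (kerAvgFlat n M)) Ws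
        ≤ ScV n M (fun _ _ => (1 : E →L[ℂ] E)) (fun _ => 0) W + 0 * ScV n M (fun _ _ => (1 : E →L[ℂ] E)) (fun _ => 0) W + 0 * qWV n M W := by
  obtain ⟨Ws, hQ, hcurl, hG⟩ := slice_flat n M W
  refine ⟨Ws, hQ, le_of_eq ?_⟩
  simp only [ScV, hcurl, hG, zero_mul, add_zero]

/-- the same with the flat average written with CONSTANT line transports `fun _ _ _ _ ↦ 1` (`lineT 1 1 = 1`). [folklore] -/
theorem hslice_flat' (W : Tor (fine n M) → Fin d → E) :
    ∃ Ws, QvL n M (fun _ _ _ _ => (1 : E →L[ℂ] E)) Ws = QvL n M (fun _ _ _ _ => (1 : E →L[ℂ] E)) W ∧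
      ScV n M (fun _ _ => (1 : E →L[ℂ] E)) (projG (fine n M) (fun _ _ => (1 : E →L[ℂ] E)) (kerAvgFlat n M)) Ws
        ≤ ScV n M (fun _ _ => (1 : E →L[ℂ] E)) (fun _ => 0) W + 0 * ScV n M (fun _ _ => (1 : E →L[ℂ] E)) (fun _ => 0) W + 0 * qWV n M W := by
  have h := hslice_flat n M W
  rwa [lineT_flat] at h

omit [InnerProductSpace ℂ E] [CompleteSpace E] [FiniteDimensional ℂ E] [NeZero n] hM in
/-- an `E`-valued function on the torus invariant under all unit shifts is constant (B5's `const_of_shift_invariant`, componentwise). [folklore] -/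
theorem const_of_shift_invariant_vec [InnerProductSpace ℂ E] {P : Fin d → ℕ} [∀ μ, NeZero (P μ)] (f : Tor P → E)
    (h : ∀ ν x, f (x + unitVec P ν) = f x) (x : Tor P) : f x = f 0 := by
  refine ext_inner_left ℂ fun v => ?_
  exact Literature.MathematicalPhysics.QuantumFieldTheory.Balaban1983to89.B5LaplaceSpectral.const_of_shift_invariant P
    (fun y => ⟪v, f y⟫_ℂ) (fun ν y => by simp only [h]) x

omit [InnerProductSpace ℂ E] [CompleteSpace E] [FiniteDimensional ℂ E] hM in
/-- the flat block mean of a constant is the constant: `Q′_1 c = c`. [folklore] -/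
theorem Qcv_flat_const [NormedSpace ℂ E] (c : E) : Qcv n M (fun _ => (1 : E →L[ℂ] E)) (fun _ => c) = fun _ => c := by
  funext y
  have hn : ((n : ℂ) ^ d) ≠ 0 := pow_ne_zero _ (by exact_mod_cast NeZero.ne n)
  simp only [Qcv, one_apply_eq_self, sum_const, card_univ, Fintype.card_fun, Fintype.card_fin]
  rw [← Nat.cast_smul_eq_nsmul ℂ, smul_smul, Nat.cast_pow, inv_mul_cancel₀ hn, one_smul]

omit [FiniteDimensional ℂ E] in
/-- **AT `U = 1` THE KERNEL IS TRIVIAL**: `λ ∈ ker Q′_1` and `div_1 D_1 λ = 0` force `λ = 0` (`Δλ = 0 ⟹ λ` constant on the torus, and a constant with zero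
block mean vanishes). [folklore] -/
theorem eq_zero_of_mem_kerAvgFlat_of_lapOp_eq_zero {f : Tor (fine n M) → E} (hf : f ∈ kerAvgFlat n M)
    (h : lapOp (fine n M) (fun _ _ => (1 : E →L[ℂ] E)) f = 0) : f = 0 := by
  have hshift : ∀ ν x, f (x + unitVec (fine n M) ν) = f x := fun ν x => by
    have := cDv_eq_zero_of_lapOp_eq_zero (fine n M) (fun _ _ => (1 : E →L[ℂ] E)) h x ν
    simpa [cDv, sub_eq_zero] using this
  have hconst : f = fun _ => f 0 := funext fun x => const_of_shift_invariant_vec f hshift x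
  have hQ : Qcv n M (fun _ => (1 : E →L[ℂ] E)) f = 0 := by simpa using hf
  rw [hconst, Qcv_flat_const] at hQ
  have h0 : f 0 = 0 := by simpa using congrFun hQ 0
  rw [hconst, h0]
  rfl

/-- **UNIQUENESS OF THE SLICE POINT AT `U = 1`**: each gauge orbit-in-fibre `{W − D_1λ : λ ∈ ker Q′_1}` meets the zero set of `projG 1 (ker Q′_1)` EXACTLY ONCE
— the zero set is a genuine gauge slice inside every fibre (this is what distinguishes `projG` from the trivial inhabitant `G = 0` of (SLICE)). [folklore] -/
theorem slice_flat_unique {W : Tor (fine n M) → Fin d → E} {f₁ f₂ : Tor (fine n M) → E} (h₁ : f₁ ∈ kerAvgFlat n M) (h₂ : f₂ ∈ kerAvgFlat n M)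
    (hz₁ : projG (fine n M) (fun _ _ => (1 : E →L[ℂ] E)) (kerAvgFlat n M) (W - cDv (fine n M) (fun _ _ => (1 : E →L[ℂ] E)) f₁) = 0)
    (hz₂ : projG (fine n M) (fun _ _ => (1 : E →L[ℂ] E)) (kerAvgFlat n M) (W - cDv (fine n M) (fun _ _ => (1 : E →L[ℂ] E)) f₂) = 0) :
    f₁ = f₂ := by
  have hlap := lapOp_eq_of_projG_eq_zero (fine n M) (fun _ _ => (1 : E →L[ℂ] E)) W h₁ h₂ hz₁ hz₂
  have hdiff : lapOp (fine n M) (fun _ _ => (1 : E →L[ℂ] E)) (f₁ - f₂) = 0 := by rw [map_sub, hlap, sub_self]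
  exact sub_eq_zero.mp (eq_zero_of_mem_kerAvgFlat_of_lapOp_eq_zero n M (Submodule.sub_mem _ h₁ h₂) hdiff)

/-- **TRANSVERSALITY AT `U = 1`**: on a nonzero gauge direction `D_1λ`, `λ ∈ ker Q′_1`, the functional is strictly positive — `projG 1 K (D_1 λ) = 0 ⟹ λ = 0`. [folklore] -/
theorem eq_zero_of_projG_gradient_eq_zero {f : Tor (fine n M) → E} (hf : f ∈ kerAvgFlat n M)
    (h : projG (fine n M) (fun _ _ => (1 : E →L[ℂ] E)) (kerAvgFlat n M) (cDv (fine n M) (fun _ _ => (1 : E →L[ℂ] E)) f) = 0) : f = 0 := by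
  rw [projG_gradient_eq_divSq (fine n M) (fun _ _ => (1 : E →L[ℂ] E)) hf] at h
  unfold divSq at h
  have hlap : lapOp (fine n M) (fun _ _ => (1 : E →L[ℂ] E)) f = 0 := by
    funext x
    have hx := (sum_eq_zero_iff_of_nonneg fun y _ => by positivity).mp h x (mem_univ x)
    rw [lapOp_apply, Pi.zero_apply, ← norm_eq_zero]
    exact pow_eq_zero_iff (n := 2) (by norm_num) |>.mp hx
  exact eq_zero_of_mem_kerAvgFlat_of_lapOp_eq_zero n M hf hlap

end SliceFlat

/-! ## §5 The dictionary with (1.70): for a symmetric automorphism `G` and a subspace `K`, `(G⁻¹K)ᗮ = G(Kᗮ)` — so the complement of `P` (the orthogonal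
projection onto `Δ⁻¹(range Q′*) = Δ⁻¹((ker Q′)ᗮ)`) is the orthogonal projection onto `Δ(ker Q′)` -/

section Dictionary

variable {V : Type*} [NormedAddCommGroup V] [InnerProductSpace ℂ V]

/-- **`(G⁻¹K)ᗮ = G(Kᗮ)`** for a symmetric linear automorphism `G` and any subspace `K` (`⟪G⁻¹k, v⟫ = ⟪k, G⁻¹v⟫`).  With `G = Δ⁻¹` on `1^⊥` and `K = ker Q′`:
`range P = Δ⁻¹(range Q′*) = G(Kᗮ)` is the orthogonal complement of `G⁻¹K = Δ(ker Q′)`, i.e. `I − P = Π_{Δ(ker Q′)}` — the reading behind `projG`. [folklore] -/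
theorem orthogonal_map_symm_eq (G : V ≃ₗ[ℂ] V) (hG : (G : V →ₗ[ℂ] V).IsSymmetric) (K : Submodule ℂ V) :
    (K.map (G.symm : V →ₗ[ℂ] V))ᗮ = Kᗮ.map (G : V →ₗ[ℂ] V) := by
  have hG' : ∀ x y : V, ⟪G x, y⟫_ℂ = ⟪x, G y⟫_ℂ := fun x y => hG x y
  have hGs : ∀ u v : V, ⟪G.symm u, v⟫_ℂ = ⟪u, G.symm v⟫_ℂ := fun u v => by
    conv_lhs => rw [← G.apply_symm_apply v]
    rw [← hG', G.apply_symm_apply]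
  ext v
  rw [Submodule.mem_orthogonal, Submodule.mem_map]
  constructor
  · intro h
    refine ⟨G.symm v, ?_, G.apply_symm_apply v⟩
    rw [Submodule.mem_orthogonal]
    intro u hu
    rw [← hGs]
    exact h _ (Submodule.mem_map_of_mem hu)
  · rintro ⟨w, hw, rfl⟩ u hu
    rw [Submodule.mem_map] at hu
    obtain ⟨k, hk, rfl⟩ := hu
    rw [Submodule.mem_orthogonal] at hw
    show ⟪G.symm k, G w⟫_ℂ = 0
    rw [hGs, G.symm_apply_apply]
    exact hw k hk

/-- the complementary form: **`(G(Kᗮ))ᗮ = G⁻¹K`** in finite dimension (double orthogonal complement). [folklore] -/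
theorem orthogonal_map_orthogonal_eq [FiniteDimensional ℂ V] (G : V ≃ₗ[ℂ] V) (hG : (G : V →ₗ[ℂ] V).IsSymmetric) (K : Submodule ℂ V) :
    (Kᗮ.map (G : V →ₗ[ℂ] V))ᗮ = K.map (G.symm : V →ₗ[ℂ] V) := by
  rw [← orthogonal_map_symm_eq G hG K, Submodule.orthogonal_orthogonal]

end Dictionary

end Summit.QuantumFields.BalabanUV.T4Continuum.VariationalVectorGaugeSliceFlat

end
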